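import Mathlib.FieldTheory.IsAlgClosed.AlgebraicClosure
import Literature.IUT.HodgeTheaters.InitialThetaDataLocalGroupsOpenProofs
import Literature.IUT.HodgeTheaters.InitialThetaDataNFBase
import Literature.AnabelianGeometry.AbsoluteAnabelian.FundamentalExtensionRestriction
import Literature.AlgebraicGeometry.Frobenioids.PadicKummerRelCosetGaloisConj
import Literature.NumberTheory.GaloisRepresentations.AbsGaloisGroup
import HarnessLib

/-!
# [IUTchI] Def. 3.1 (b), (d): the Galois groups of `C_F ⊇ X_F ⊇ X_K`, `C_K` at an initial Θ-datum,
# identified with Mathlib's absolute Galois groups `Gal(F^alg/F)`, `Gal(K^alg/K)` in `ProfiniteGrp`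

S. Mochizuki, *Inter-universal Teichmüller theory I*, §3, Definition 3.1 (b), (d), (e) (kurims final
manuscript, May 2020, pp. 61–63) [claim: Mochizuki2012, status: disputed]: "`G_F := Gal(F̄/F)`",
"`C_K := C_F ×_F K`", "`X_K := X_F ×_F K`", "`G_K := Gal(F̄/K)`".  PLUMBING over the REAL
`InitialThetaData` of `InitialThetaData.lean` (abc-iut-L5-t2) for the named model
`InitialThetaData.nfCurveModel` (abc-iut cell, GAP B item GB-07 = `GAP-SIZING-B.md` row D7; sibling file
`InitialThetaDataCurveModel.lean`).  The interface `[AbsTopIII] CurveModel` (abc-iut-L4-t1,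
`AbsTopIII/CurveModel.lean`) asks, for every curve `U`, for an isomorphism IN `ProfiniteGrp`
`(ext U).gal ≅ absoluteGaloisGrp (base U)`, where `absoluteGaloisGrp k = ProfiniteGrp.of (Gal(k^alg/k))`,
`k^alg := AlgebraicClosure k` (Mathlib's `Field.absoluteGaloisGroup`); the datum carries ITS OWN algebraic
closure `F̄ = Fbar` and the bicontinuous identification `galIso : G ≃* Gal(F̄/F)` of `ThetaGeometry`.
Everything needed is already in the tree and is only ASSEMBLED here (no new interface, no choice beyond
`IsAlgClosure.equiv`):

* generic: `autCongrContinuous ι : Gal(L/k) ≃ₜ* Gal(L'/k)` (conjugation by `ι : L ≃ₐ[k] L'`; continuity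
  = the tree's `GaloisConj.continuous_autCongr`, [FrdII] file `PadicKummerRelCosetGaloisConj.lean`);
  `subgroupCongrContinuous` (a bicontinuous `e : G ≃ₜ* G'` restricts to `H ≃ₜ* e(H)`); `topEquivContinuous`;
* at the datum `D`: `D.galFEquiv : G ≃ₜ* Gal(F̄/F)` (the fields `galIso` + `galIso_continuous`),
  `D.algClosureEquivF : F̄ ≃ₐ[F] F^alg`, `D.galFAbsEquiv : G ≃ₜ* Gal(F^alg/F)`;
  `D.galKAbsEquiv : G_K ≃ₜ* Gal(K^alg/K)` = the inverse of `InitialThetaDataNFBase.lean`'s continuous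
  bijection `D.absGalToGK` / homeomorphism `D.absGalHomeomorph` (abc-iut, `peNFBase`);
  `D.map_augGF_PiCK`, `D.map_augGF_PiXK`: the images of `Π_{C_K}`, `Π_{X_K} ⊆ Π_{C_F}` under
  `augGF : Π_{C_F} ↠ G_F` are EXACTLY `G_K` (with the tree's `D.map_augGF_PiX : augGF(Π_{X_F}) = G_F`);
* the four isomorphisms consumed by the model (ONE universe `F K F̄ : Type u`, forced by `CurveModel.{u}`):
  `D.galIsoCF : G ≅ absoluteGaloisGrp F`, `D.galIsoXF`, `D.galIsoCK`, `D.galIsoXK`, where the extensions of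
  `X_F`, `C_K`, `X_K` are the tree's adapter A1 `FundamentalExtension.ofOpenSubgroup`
  (`FundamentalExtensionRestriction.lean`, abc-iut-w5-d053) at the open subgroups `D.geom.PiX`, `D.PiCK`,
  `D.PiXK ⊆ Π_{C_F}` (openness: `InitialThetaDataLocalGroupsOpenProofs.lean`), whose Galois groups are the
  images `aug(U) ⊆ G`.

Pure field theory / profinite-group plumbing; nothing of the disputed series is asserted, no side is taken
on [IUTchIII] Cor. 3.12; no `instance`, no notation.
-/

noncomputable section

namespace Literature.IUT.HodgeTheaters

open CategoryTheory Topology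
open Literature.AnabelianGeometry.AbsoluteAnabelian

universe u v w

namespace InitialThetaData

/-! ### Generic bicontinuous isomorphisms -/

/-- Conjugation by an isomorphism `ι : L ≃ₐ[k] L'` of extensions of `k`, `σ ↦ ι ∘ σ ∘ ι⁻¹` (Mathlib
`AlgEquiv.autCongr`; on elements `autCongrContinuous ι σ = ι.symm.trans (σ.trans ι)`, `rfl`), as an
isomorphism of TOPOLOGICAL groups `Gal(L/k) ≃ₜ* Gal(L'/k)` for the Krull topologies (continuity both
ways: the tree's `GaloisConj.continuous_autCongr`). [folklore] -/
def autCongrContinuous {k L L' : Type*} [Field k] [Field L] [Field L'] [Algebra k L] [Algebra k L']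
    (ι : L ≃ₐ[k] L') : (L ≃ₐ[k] L) ≃ₜ* (L' ≃ₐ[k] L') :=
  { AlgEquiv.autCongr ι with
    continuous_toFun := Literature.AlgebraicGeometry.Frobenioids.GaloisConj.continuous_autCongr ι
    continuous_invFun :=
      Literature.AlgebraicGeometry.Frobenioids.GaloisConj.continuous_autCongr ι.symm }

/-- A bicontinuous isomorphism of topological groups `e : G ≃ₜ* G'` restricts to a bicontinuous
isomorphism `H ≃ₜ* H'` of subgroups (subspace topologies) whenever `e(H) = H'`; on elements it is `e`
(`rfl`). [folklore] -/
def subgroupCongrContinuous {G G' : Type*} [Group G] [Group G'] [TopologicalSpace G]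
    [TopologicalSpace G'] (e : G ≃ₜ* G') (H : Subgroup G) (H' : Subgroup G')
    (h : H.map (e : G →* G') = H') : H ≃ₜ* H' :=
  { (e.toMulEquiv.subgroupMap H).trans (MulEquiv.subgroupCongr h) with
    continuous_toFun := by
      apply Continuous.subtype_mk
      exact e.continuous.comp continuous_subtype_val
    continuous_invFun := by
      apply Continuous.subtype_mk
      exact e.symm.continuous.comp continuous_subtype_val }

/-- The top subgroup `⊤ ≤ G` with its subspace topology is bicontinuously isomorphic to `G` (Mathlib
`Subgroup.topEquiv`). [folklore] -/
def topEquivContinuous (G : Type*) [Group G] [TopologicalSpace G] : (⊤ : Subgroup G) ≃ₜ* G :=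
  { Subgroup.topEquiv with
    continuous_toFun := continuous_subtype_val
    continuous_invFun := Continuous.subtype_mk continuous_id _ }

/-! ### At the datum: `G ≅ Gal(F̄/F) ≅ Gal(F^alg/F)` and `augGF(Π_{C_K}) = augGF(Π_{X_K}) = G_K` -/

section Datum

variable {F : Type u} {K : Type v} {Fbar : Type w} [Field F] [NumberField F] [Field K]
  [NumberField K] [Algebra F K] [Field Fbar] [Algebra F Fbar] [Algebra K Fbar]
  {E : WeierstrassCurve F} [E.IsElliptic] {l : ℕ} {Pb : BadPlacePredicates K}
  (D : InitialThetaData F K Fbar E l Pb)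

/-- The Galois group `G` of the interface extension `Π_{C_F} ↠ G` IS `Gal(F̄/F)`, bicontinuously: the
fields `galIso`, `galIso_continuous` of `ThetaGeometry` packaged as a `ContinuousMulEquiv` (Def. 3.1 (b)
"`G_F := Gal(F̄/F)`"). [claim: Mochizuki2012, status: disputed] -/
def galFEquiv : D.geom.extF.gal ≃ₜ* (Fbar ≃ₐ[F] Fbar) :=
  { D.geom.galIso with
    continuous_toFun := D.geom.galIso_continuous.1
    continuous_invFun := D.geom.galIso_continuous.2 }

/-- `galFEquiv` is `galIso` on elements. [claim: Mochizuki2012, status: disputed] -/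
@[simp] theorem galFEquiv_apply (g : D.geom.extF.gal) : D.galFEquiv g = D.geom.galIso g := rfl

/-- `galFEquiv` after the augmentation is `augGF` (`InitialThetaDataLocalGroups.lean`).
[claim: Mochizuki2012, status: disputed] -/
theorem galFEquiv_aug (x : D.PiC) : D.galFEquiv (D.geom.extF.aug x) = D.augGF x := rfl

/-- `F̄ ≃ₐ[F] F^alg`: the datum's algebraic closure of `F` (Def. 3.1 (a) "`F̄` is an algebraic closure of
`F`") versus Mathlib's `AlgebraicClosure F`, by `IsAlgClosure.equiv` (a choice; any two choices differ by an
element of `Gal(F^alg/F)`; the `K`-linear analogue is `InitialThetaDataNFBase.lean`'s `D.algClosureEquiv`).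
[claim: Mochizuki2012, status: disputed] -/
def algClosureEquivF : Fbar ≃ₐ[F] AlgebraicClosure F :=
  haveI := D.isAlgClosure
  IsAlgClosure.equiv F Fbar (AlgebraicClosure F)

/-- `G ≃ₜ* Gal(F^alg/F) = Field.absoluteGaloisGroup F`: `galFEquiv` followed by conjugation with
`algClosureEquivF`. [claim: Mochizuki2012, status: disputed] -/
def galFAbsEquiv : D.geom.extF.gal ≃ₜ* Field.absoluteGaloisGroup F :=
  D.galFEquiv.trans (autCongrContinuous D.algClosureEquivF)

/-- Values of `galFAbsEquiv` as automorphisms of `F^alg`: `ι ∘ galIso(g) ∘ ι⁻¹`, `ι = algClosureEquivF`.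
[claim: Mochizuki2012, status: disputed] -/
theorem galFAbsEquiv_apply_apply (g : D.geom.extF.gal) (y : AlgebraicClosure F) :
    Field.absoluteGaloisGroup.toAlgEquiv F (D.galFAbsEquiv g) y =
      D.algClosureEquivF (D.geom.galIso g (D.algClosureEquivF.symm y)) := rfl

/-- For an open subgroup `U ⊆ Π_{C_F}`: `galIso` carries the image `aug(U) ⊆ G` (the Galois group of the
adapter `extF.ofOpenSubgroup U`) onto `augGF(U) ⊆ Gal(F̄/F)`. [claim: Mochizuki2012, status: disputed] -/
theorem map_galFEquiv_augImage (U : OpenSubgroup D.PiC) :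
    (D.geom.extF.augImage U).toSubgroup.map (D.galFEquiv : D.geom.extF.gal →* (Fbar ≃ₐ[F] Fbar)) =
      (U : Subgroup D.PiC).map D.augGF := by
  change ((U : Subgroup D.PiC).map D.geom.extF.aug.toMonoidHom).map D.geom.galIso.toMonoidHom = _
  rw [Subgroup.map_map]
  rfl

/-- **`Π_{C_K} ↠ G_K` exactly**: the image of `Π_{C_K} = Π_{C_F} ×_{G_F} G_K ⊆ Π_{C_F}` under
`augGF : Π_{C_F} ↠ G_F` is `G_K` (field `embK_range` of `ThetaGeometry`; Def. 3.1 (d) "`C_K := C_F ×_F K`").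
[claim: Mochizuki2012, status: disputed] -/
theorem map_augGF_PiCK : D.PiCK.map D.augGF = galoisSubgroupOf F K Fbar := by
  change (D.geom.embK.range).map D.augGF = _
  rw [D.geom.embK_range]
  exact Subgroup.map_comap_eq_self_of_surjective D.augGF_surjective _

/-- **`Π_{X_K} ↠ G_K` exactly**: the image of `Π_{X_K} = Π_{X_F} ∩ Π_{C_K}` under `augGF` is `G_K`
(`⊇` is the tree's `galoisSubgroupOf_le_map_of_PiXund_le`, i.e. `Π_{X̲_K} ↠ G_K` from the field `aug_PiXbar`;
Def. 3.1 (d) "`X_K := X_F ×_F K`"). [claim: Mochizuki2012, status: disputed] -/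
theorem map_augGF_PiXK : D.PiXK.map D.augGF = galoisSubgroupOf F K Fbar := by
  haveI := D.isScalarTower
  refine le_antisymm ?_ (D.galoisSubgroupOf_le_map_of_PiXund_le D.PiXund_le_PiXK)
  exact (Subgroup.map_mono (f := D.augGF) (inf_le_right : D.PiXK ≤ D.PiCK)).trans
    D.map_augGF_PiCK.le

/-- `Π_{X_F} ⊆ Π_{C_F}` as an open subgroup (fields `PiX`, `PiX_isOpen`; Def. 3.1 (b)).
[claim: Mochizuki2012, status: disputed] -/
def openPiX : OpenSubgroup D.PiC := ⟨D.geom.PiX, D.geom.PiX_isOpen⟩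

/-- `Π_{C_K} ⊆ Π_{C_F}` as an open subgroup (`D.PiCK`; openness `isOpen_PiCK`; Def. 3.1 (d)).
[claim: Mochizuki2012, status: disputed] -/
def openPiCK : OpenSubgroup D.PiC := ⟨D.PiCK, by haveI := D.isScalarTower; exact D.isOpen_PiCK⟩

/-- `Π_{X_K} ⊆ Π_{C_F}` as an open subgroup (`D.PiXK`; openness `isOpen_PiXK`; Def. 3.1 (d)).
[claim: Mochizuki2012, status: disputed] -/
def openPiXK : OpenSubgroup D.PiC := ⟨D.PiXK, by haveI := D.isScalarTower; exact D.isOpen_PiXK⟩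

/-- Underlying subgroup of `openPiX`. [claim: Mochizuki2012, status: disputed] -/
@[simp] theorem coe_openPiX : (D.openPiX : Subgroup D.PiC) = D.geom.PiX := rfl

/-- Underlying subgroup of `openPiCK`. [claim: Mochizuki2012, status: disputed] -/
@[simp] theorem coe_openPiCK : (D.openPiCK : Subgroup D.PiC) = D.PiCK := rfl

/-- Underlying subgroup of `openPiXK`. [claim: Mochizuki2012, status: disputed] -/
@[simp] theorem coe_openPiXK : (D.openPiXK : Subgroup D.PiC) = D.PiXK := rfl

end Datum

/-! ### `G_K ≅ Gal(K^alg/K)` and the four isomorphisms in `ProfiniteGrp` (one universe) -/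

section Isos

variable {F K Fbar : Type u} [Field F] [NumberField F] [Field K] [NumberField K] [Algebra F K]
  [Field Fbar] [Algebra F Fbar] [Algebra K Fbar] {E : WeierstrassCurve F} [E.IsElliptic] {l : ℕ}
  {Pb : BadPlacePredicates K} (D : InitialThetaData F K Fbar E l Pb)

include D in
/-- **`G_K ≃ₜ* Gal(K^alg/K) = Field.absoluteGaloisGroup K`**, bicontinuously: the INVERSE of
`InitialThetaDataNFBase.lean`'s continuous bijective homomorphism `D.absGalToGK : Gal(K^alg/K) → G_K`
(restriction of scalars after transport along `D.algClosureEquiv : F̄ ≅_K K^alg`), a homeomorphism by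
compact-to-Hausdorff (`D.absGalHomeomorph`) (Def. 3.1 (e) "`G_K := Gal(F̄/K)`").
[claim: Mochizuki2012, status: disputed] -/
def galKAbsEquiv : galoisSubgroupOf F K Fbar ≃ₜ* Field.absoluteGaloisGroup K :=
  { (MulEquiv.ofBijective D.absGalToGK D.absGalToGK_bijective).symm with
    continuous_toFun := D.absGalHomeomorph.symm.continuous
    continuous_invFun := D.absGalHomeomorph.continuous }

/-- `galKAbsEquiv⁻¹ = absGalToGK`. [claim: Mochizuki2012, status: disputed] -/
@[simp] theorem galKAbsEquiv_symm_apply (σ : Field.absoluteGaloisGroup K) :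
    D.galKAbsEquiv.symm σ = D.absGalToGK σ := rfl

/-- `absGalToGK (galKAbsEquiv τ) = τ`. [claim: Mochizuki2012, status: disputed] -/
@[simp] theorem absGalToGK_galKAbsEquiv (τ : galoisSubgroupOf F K Fbar) :
    D.absGalToGK (D.galKAbsEquiv τ) = τ :=
  (MulEquiv.ofBijective D.absGalToGK D.absGalToGK_bijective).apply_symm_apply τ

/-- **`G_{C_F} ≅ Gal(F^alg/F)`** in `ProfiniteGrp` (`galFAbsEquiv`). [claim: Mochizuki2012, status: disputed] -/
def galIsoCF : D.geom.extF.gal ≅ absoluteGaloisGrp F :=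
  ProfiniteGrp.ContinuousMulEquiv.toProfiniteGrpIso
    (X := D.geom.extF.gal) (Y := absoluteGaloisGrp F) D.galFAbsEquiv

/-- **`G_{X_F} = aug(Π_{X_F}) = G ≅ Gal(F^alg/F)`** in `ProfiniteGrp` (`Π_{X_F} ↠ G_F`: the tree's
`map_augGF_PiX`). [claim: Mochizuki2012, status: disputed] -/
def galIsoXF : (D.geom.extF.ofOpenSubgroup D.openPiX).gal ≅ absoluteGaloisGrp F :=
  ProfiniteGrp.ContinuousMulEquiv.toProfiniteGrpIso
    (X := (D.geom.extF.ofOpenSubgroup D.openPiX).gal) (Y := absoluteGaloisGrp F)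
    ((subgroupCongrContinuous D.galFEquiv (D.geom.extF.augImage D.openPiX).toSubgroup ⊤
        (by rw [map_galFEquiv_augImage]; exact D.map_augGF_PiX)).trans
      ((topEquivContinuous _).trans (autCongrContinuous D.algClosureEquivF)))

/-- **`G_{C_K} = aug(Π_{C_K}) = G_K ≅ Gal(K^alg/K)`** in `ProfiniteGrp` (`map_augGF_PiCK`, `galKAbsEquiv`).
[claim: Mochizuki2012, status: disputed] -/
def galIsoCK : (D.geom.extF.ofOpenSubgroup D.openPiCK).gal ≅ absoluteGaloisGrp K :=
  ProfiniteGrp.ContinuousMulEquiv.toProfiniteGrpIso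
    (X := (D.geom.extF.ofOpenSubgroup D.openPiCK).gal) (Y := absoluteGaloisGrp K)
    ((subgroupCongrContinuous D.galFEquiv (D.geom.extF.augImage D.openPiCK).toSubgroup
        (galoisSubgroupOf F K Fbar) (by rw [map_galFEquiv_augImage]; exact D.map_augGF_PiCK)).trans
      D.galKAbsEquiv)

/-- **`G_{X_K} = aug(Π_{X_K}) = G_K ≅ Gal(K^alg/K)`** in `ProfiniteGrp` (`map_augGF_PiXK`, `galKAbsEquiv`).
[claim: Mochizuki2012, status: disputed] -/
def galIsoXK : (D.geom.extF.ofOpenSubgroup D.openPiXK).gal ≅ absoluteGaloisGrp K :=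
  ProfiniteGrp.ContinuousMulEquiv.toProfiniteGrpIso
    (X := (D.geom.extF.ofOpenSubgroup D.openPiXK).gal) (Y := absoluteGaloisGrp K)
    ((subgroupCongrContinuous D.galFEquiv (D.geom.extF.augImage D.openPiXK).toSubgroup
        (galoisSubgroupOf F K Fbar) (by rw [map_galFEquiv_augImage]; exact D.map_augGF_PiXK)).trans
      D.galKAbsEquiv)

/-- `galIsoCF` on elements, as automorphisms of `F^alg`: `ι ∘ galIso(g) ∘ ι⁻¹`.
[claim: Mochizuki2012, status: disputed] -/
theorem galIsoCF_hom_apply_apply (g : D.geom.extF.gal) (y : AlgebraicClosure F) :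
    Field.absoluteGaloisGroup.toAlgEquiv F (D.galIsoCF.hom g) y =
      D.algClosureEquivF (D.geom.galIso g (D.algClosureEquivF.symm y)) := rfl

/-- `galIsoXF` on elements: `ι ∘ galIso(g) ∘ ι⁻¹` for `g ∈ aug(Π_{X_F}) ⊆ G`.
[claim: Mochizuki2012, status: disputed] -/
theorem galIsoXF_hom_apply_apply (g : (D.geom.extF.ofOpenSubgroup D.openPiX).gal)
    (y : AlgebraicClosure F) :
    Field.absoluteGaloisGroup.toAlgEquiv F (D.galIsoXF.hom g) y =
      D.algClosureEquivF (D.geom.galIso g.1 (D.algClosureEquivF.symm y)) := rfl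

/-- `galIsoCK` composed with `absGalToGK` is `galIso` on underlying elements of `G`: the element of
`G_K ⊆ Gal(F̄/F)` attached to `g ∈ aug(Π_{C_K})` is `galIso g`. [claim: Mochizuki2012, status: disputed] -/
theorem absGalToGK_galIsoCK_hom (g : (D.geom.extF.ofOpenSubgroup D.openPiCK).gal) :
    (D.absGalToGK (D.galIsoCK.hom g) : Fbar ≃ₐ[F] Fbar) = D.geom.galIso g.1 :=
  congrArg Subtype.val (D.absGalToGK_galKAbsEquiv _)

/-- `galIsoXK` composed with `absGalToGK` is `galIso` on underlying elements of `G`.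
[claim: Mochizuki2012, status: disputed] -/
theorem absGalToGK_galIsoXK_hom (g : (D.geom.extF.ofOpenSubgroup D.openPiXK).gal) :
    (D.absGalToGK (D.galIsoXK.hom g) : Fbar ≃ₐ[F] Fbar) = D.geom.galIso g.1 :=
  congrArg Subtype.val (D.absGalToGK_galKAbsEquiv _)

end Isos

end InitialThetaData
end Literature.IUT.HodgeTheaters
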